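import Mathlib.NumberTheory.Height.NumberField
import Mathlib.NumberTheory.NumberField.Discriminant.Defs
import Mathlib.RingTheory.Radical.NatInt
import Literature.IUT.LogVolume.ExplicitEstimatesCorollary52
import HarnessLib

/-!
# [ExpEst] Theorem 5.3 (Effective versions of ABC/Szpiro inequalities over mono-complex number
# fields) and Corollary 5.9 (generalized Fermat equation) — the downstream explicit abc-type
# CANDIDATE statements, typed as claim-tagged predicates; nothing disputed asserted

S. Mochizuki, I. Fesenko, Y. Hoshi, A. Minamide, W. Porowski, *Explicit estimates in inter-universal
Teichmüller theory*, Kodai Math. J. **45** (2022) 175–236 — [ExpEst], bib key `MochizukiEtAl2022` (D-0012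
claim key, status disputed). **Theorem 5.3** (= Introduction, Theorem A): statement p. 219–220 (pdf
p45.l16 – p46.l10 of the cell render `run/shared/lean/pub/abc-iut/plan/repair/lit/renders/MFHMP-Explicit
Estimates-Kodai2022-book-anonnd-eeiutp`; journal page = pdf page + 174); **Corollary 5.9**: p. 233
(p59.l38–49). Definition 1.1 (i) (Weil heights `h_non`, `h_arc`, `h`): p. 184–185 (p10.l21 – p11.l0).

TAKES NO SIDE on [IUTchIII] Corollary 3.12 or on any author. Theorem 5.3 is proved in print from
Corollary 5.2 (p. 220: "Assertion (i) follows immediately from Corollary 5.2"), hence through Theorem 5.1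
and the μ₆-version of [IUTchIII] Cor. 3.12, whose proof is disputed [cite: ScholzeStix2018, §2.2 p. 10];
Corollary 5.9 is proved from Theorem 5.4 (= Theorem B, the tree's
`Literature.Barriers.ABC.IUTDisputedClaim`, an `@[conjecture]` def, registered OPEN). Hence every
statement below is a CANDIDATE: a claim-tagged `Prop`-valued PREDICATE in its data (`L, a, b, c, ε`,
resp. `r, s, t, l, m, n`) — the closed universally quantified sentences are deliberately not declared
(no closed disputed statement in `Literature/`; cf. `Cor22.Corollary22`, `ExpEst.PartKappa`); never
asserted, never a Literature fact; typed ≠ proved ≠ endorsed; no abc claim.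

## Rendering of the printed nouns (Mathlib where it exists)

* "`H_L(a,b,c) := ∏_{v ∈ 𝕍(L)} max{|a|_v, |b|_v, |c|_v}`" (p46 top display = p. 220) with [ExpEst]'s
  normalisations `|x|_v := ‖x‖_v^{[L_v:ℚ_{p_v}]}` (nonarchimedean; = `N(𝔭_v)^{−ord_v(x)}`) and `|x|_v :=
  ‖x‖_v^{[L_v:ℝ]}` (archimedean) (§0 "Numbers", p. 183–184): this is EXACTLY Mathlib's multiplicative height
  of the tuple, `Height.mulHeight ![a, b, c]` (`NumberField.mulHeight_eq`: infinite places with exponent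
  `mult`, finite places with Mathlib's normalised `‖·‖_w`); over `ℚ` and coprime integer entries it is
  `max{|a|,|b|,|c|}` (`NumberField.mulHeight_eq_max_abs_of_gcd_eq_one`).
* "`I_L(a,b,c) := {v ∈ 𝕍(L)^non | #{|a|_v, |b|_v, |c|_v} ≥ 2}`", "`rad_L(a,b,c) := ∏_{v ∈ I_L(a,b,c)} #(𝒪_L/𝔭_v)`"
  (p45.l30–43): `radL a b c`, a `finprod` over Mathlib's `NumberField.FinitePlace L` of `N(𝔭_w)`
  (`Ideal.absNorm` of `w.maximalIdeal`) over the places where `‖a‖_w, ‖b‖_w, ‖c‖_w` are not all equal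
  (finite for `a, b, c ≠ 0`; junk value `1` otherwise). Over `ℚ`, for coprime `a + b + c = 0`, this is
  `rad(abc)` (every `p ∣ abc` divides exactly one of them).
* "`Δ_L` … the absolute value of the discriminant of `L`": `(NumberField.discr L).natAbs`; "`d := [L:ℚ]`":
  `Module.finrank ℚ L` (`∈ {1, 2}` for mono-complex `L`, Def. 1.2 = `ExpEst.IsMonoComplex`).
* "`E_{a,b,c}` … defined by `y² = x(x−1)(x + a/c)`; `j(E_{a,b,c})`": the Legendre curve with `λ = −a/c`, so
  `j(E_{a,b,c}) = Cor22.jInv (−(a/c))` (`jInv λ = 2^8(λ²−λ+1)³/(λ²(λ−1)²)`).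
* "`h_non(α) := (1/[F:ℚ])·Σ_{v ∈ 𝕍(F)^non} log max{|α|_v, 1}`" (Def. 1.1 (i), p10.l21–30): `hNon α`, via
  Mathlib's `log⁺` and `finsum` over `FinitePlace` (the nonarchimedean part of `NumberField.logHeight₁_eq`,
  normalised by `1/[F:ℚ]`).
* `h_d(ε)` is `ExpEst.hd` of `ExplicitEstimatesCorollary52.lean` (Thm. 5.3 repeats the `d = 1, 2` cases).
* `rad(rst)` in Cor. 5.9 is `UniqueFactorizationMonoid.radical` in `ℤ` (as in `IUTDisputedClaim`); `‖·‖_ℂ`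
  on `ℤ` is `|·|`; "coprime [i.e., the set of prime numbers which divide `x, y,` and `z` is empty]" is
  `Int.gcd (Int.gcd x y) z = 1`; "every two of which are coprime" is pairwise `Int.gcd = 1`.

Deliberately NOT here: Theorem 5.4 (= `Literature.Barriers.ABC.IUTDisputedClaim`, not restated);
Corollary 5.8 ("FLT for `p > 1.615·10^14`": its STATEMENT is a theorem in print by other means (Wiles),
only [ExpEst]'s route to it is disputed — not typed, to mint no fact without a consumer); Lemmas
5.5–5.7; the proofs (Claims 5.3A, 5.4A–C); the identification of the `ℚ`-specialisation of `Thm53ii` with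
Theorem A (ii) at `L = ℚ` as recorded in `IUTDisputedClaim`'s docstring (`IUTDisputedClaim.max_abs_le_thmA`
derives that form from Theorem B); any judgement on Cor. 3.12.
-/

noncomputable section

namespace Literature.IUT.LogVolume

namespace ExpEst

open NumberField Real Literature.NumberTheory.DiophantineGeometry.GenEll Cor22

variable {L : Type*} [Field L] [NumberField L]

/-! ## 1. The nouns of Theorem 5.3 -/

/-- **[ExpEst] Definition 1.1 (i), nonarchimedean part** (p. 184 = p10.l21–30): "`h_non(α) := (1/[F:ℚ])·
Σ_{v ∈ 𝕍(F)^non} log max{|α|_v, 1} (≥ 0)`", with `|α|_v = ‖α‖_v^{[F_v:ℚ_p]}` = Mathlib's normalised finite-place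
absolute value; `log max{t, 1} = log⁺ t`. [cite: MochizukiEtAl2022, Def 1.1 (i) p. 184] -/
def hNon (α : L) : ℝ := (Module.finrank ℚ L : ℝ)⁻¹ * ∑ᶠ w : FinitePlace L, log⁺ (w α)

/-- `h_non(α) ≥ 0` (printed "(≥ 0)", p10.l24). [cite: MochizukiEtAl2022, Def 1.1 (i) p. 184] -/
theorem hNon_nonneg (α : L) : 0 ≤ hNon α := by
  unfold hNon
  exact mul_nonneg (by positivity) (finsum_nonneg fun w => posLog_nonneg)

/-- "`rad_L(a,b,c) := ∏_{v ∈ I_L(a,b,c)} #(𝒪_L/𝔭_v)`", "`I_L(a,b,c) := {v ∈ 𝕍(L)^non | #{|a|_v, |b|_v, |c|_v} ≥ 2}`"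
(Thm. 5.3, p. 219 = p45.l30–43): the product of the residue cardinalities `N(𝔭_w)` over the finite places
`w` at which `|a|_w, |b|_w, |c|_w` are NOT all equal. A `finprod` (value `1` off a finite set when `a, b, c ≠
0`; junk value `1` if the support were infinite). [cite: MochizukiEtAl2022, Thm 5.3 p. 219] -/
def radL (a b c : L) : ℕ :=
  ∏ᶠ w : FinitePlace L, if w a = w b ∧ w b = w c then 1 else Ideal.absNorm w.maximalIdeal.asIdeal

/-- "`Δ_L` for the absolute value of the discriminant of `L`" (Thm. 5.3, p45.l22–23).
[cite: MochizukiEtAl2022, Thm 5.3 p. 219] -/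
def absDisc (L : Type*) [Field L] [NumberField L] : ℕ := (NumberField.discr L).natAbs

/-- `Δ_ℚ = 1`. [cite: MochizukiEtAl2022, Thm 5.3 p. 219] -/
theorem absDisc_rat : absDisc ℚ = 1 := by
  unfold absDisc; rw [NumberField.discr_rat]; rfl

/-! ## 2. Theorem 5.3 (i), (ii) as candidate predicates (p. 219–220) -/

/-- **[ExpEst] Theorem 5.3 (i)** (p. 219 = p45.l16–51): "Let `L` be a mono-complex number field [cf.
Definition 1.2]; `a, b, c ∈ L^×` … such that `a + b + c = 0`; `ε` a positive real number `≤ 1`. Write `E_{a,b,c}`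
for the elliptic curve over `L` defined by the equation `y² = x(x−1)(x + a/c)`; … `d := [L:ℚ]`; … Then … (i)
We have [cf. Definition 1.1, (i)] `(1/6)·h_non(j(E_{a,b,c})) ≤ max{(1/d)·(1+ε)·log(Δ_L·rad_L(a,b,c)), (1/6)·
h_d(ε)} ≤ (1/d)·(1+ε)·log(Δ_L·rad_L(a,b,c)) + (1/6)·h_d(ε)`." Typed: the `max` form (the second inequality is
`max ≤ sum` of nonnegative reals, `thm53i_sum_form`), `j(E_{a,b,c}) = jInv(−a/c)`. CANDIDATE predicate in
`(L, a, b, c, ε)`; never asserted. [claim: MochizukiEtAl2022, status: disputed] -/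
@[claim "MochizukiEtAl2022" "disputed"]
def Thm53i (L : Type*) [Field L] [NumberField L] (a b c : L) (ε : ℝ) : Prop :=
  IsMonoComplex L → a ≠ 0 → b ≠ 0 → c ≠ 0 → a + b + c = 0 → 0 < ε → ε ≤ 1 →
    1 / 6 * hNon (jInv (-(a / c))) ≤
      max ((Module.finrank ℚ L : ℝ)⁻¹ * (1 + ε) * Real.log ((absDisc L : ℝ) * (radL a b c : ℝ)))
        (1 / 6 * hd (Module.finrank ℚ L) ε)

/-- **[ExpEst] Theorem 5.3 (ii)** (p. 220 = p46.l1–10): under the same hypotheses, "`H_L(a,b,c) ≤ 2^{5d/2}·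
max{exp((d/4)·h_d(ε)), (Δ_L·rad_L(a,b,c))^{3(1+ε)/2}} ≤ 2^{5d/2}·exp((d/4)·h_d(ε))·(Δ_L·rad_L(a,b,c))^{3(1+ε)/2}`", with
`H_L(a,b,c) = ∏_{v ∈ 𝕍(L)} max{|a|_v, |b|_v, |c|_v}` = Mathlib's `Height.mulHeight ![a, b, c]`. Typed: the `max` form.
At `L = ℚ` (`d = 1`, `Δ_ℚ = 1`, `H_ℚ = max{|a|,|b|,|c|}` for coprime integers, `rad_ℚ = rad(abc)`) this is
Theorem A (ii) at `ℚ`, the form derived from Theorem B in `IUTDisputedClaimProofs.lean`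
(`IUTDisputedClaim.max_abs_le_thmA`). CANDIDATE predicate; never asserted. [claim: MochizukiEtAl2022, status: disputed] -/
@[claim "MochizukiEtAl2022" "disputed"]
def Thm53ii (L : Type*) [Field L] [NumberField L] (a b c : L) (ε : ℝ) : Prop :=
  IsMonoComplex L → a ≠ 0 → b ≠ 0 → c ≠ 0 → a + b + c = 0 → 0 < ε → ε ≤ 1 →
    Height.mulHeight ![a, b, c] ≤
      (2 : ℝ) ^ (5 * (Module.finrank ℚ L : ℝ) / 2) *
        max (Real.exp ((Module.finrank ℚ L : ℝ) / 4 * hd (Module.finrank ℚ L) ε))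
          (((absDisc L : ℝ) * (radL a b c : ℝ)) ^ (3 * (1 + ε) / 2))

/-- The printed second inequality of Thm. 5.3 (i), "`max{A, B} ≤ A + B`", holds whenever `A, B ≥ 0` — here
`A = (1/d)(1+ε)·log(Δ_L·rad_L) ≥ 0` (`Δ_L·rad_L ≥ 1`) and `B = (1/6)·h_d(ε) ≥ 0`; recorded as the elementary real
fact it is. [cite: MochizukiEtAl2022, Thm 5.3 (i) p. 219] -/
theorem thm53i_sum_form {A B x : ℝ} (hA : 0 ≤ A) (hB : 0 ≤ B) (h : x ≤ max A B) : x ≤ A + B :=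
  le_trans h (max_le (by linarith) (by linarith))

/-- Likewise for Thm. 5.3 (ii): "`C·max{A, B} ≤ C·A·B`" whenever `C ≥ 0`, `A, B ≥ 1` (here `A = exp(…) ≥ 1`,
`B = (Δ_L·rad_L)^{…} ≥ 1`). [cite: MochizukiEtAl2022, Thm 5.3 (ii) p. 220] -/
theorem thm53ii_product_form {A B C x : ℝ} (hC : 0 ≤ C) (hA : 1 ≤ A) (hB : 1 ≤ B)
    (h : x ≤ C * max A B) : x ≤ C * A * B := by
  have hmax : max A B ≤ A * B := max_le (by nlinarith) (by nlinarith)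
  calc x ≤ C * max A B := h
    _ ≤ C * (A * B) := mul_le_mul_of_nonneg_left hmax hC
    _ = C * A * B := by ring

/-! ## 3. Corollary 5.9 (generalized Fermat equation) as a candidate predicate (p. 233) -/

/-- **[ExpEst] Corollary 5.9** (p. 233 = p59.l38–49): "Let `r, s, t` be nonzero integers every two of which
are coprime. Write `S := {(X, Y, Z) ∈ ℤ³ | ‖XYZ‖_ℂ ≥ 2}`. Let `l, m, n` be positive integers such that
`min{l, m, n} > max{2.453·10^30, log₂ ‖rst‖_ℂ, 10 + 5·log₂(rad(rst))}`. Then there does not exist any triple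
`(x, y, z) ∈ S` of coprime [i.e., the set of prime numbers which divide `x, y,` and `z` is empty] integers
that satisfies the equation `r·x^l + s·y^m + t·z^n = 0`." Proved in print from Theorem 5.4 (= Theorem B =
`Literature.Barriers.ABC.IUTDisputedClaim`), hence downstream of the disputed Cor. 3.12; NOT known
unconditionally. CANDIDATE predicate in `(r, s, t, l, m, n)`; never asserted. [claim: MochizukiEtAl2022, status: disputed] -/
@[claim "MochizukiEtAl2022" "disputed"]
def Cor59 (r s t : ℤ) (l m n : ℕ) : Prop :=
  r ≠ 0 → s ≠ 0 → t ≠ 0 → Int.gcd r s = 1 → Int.gcd s t = 1 → Int.gcd r t = 1 →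
    0 < l → 0 < m → 0 < n →
    max (2.453e30 : ℝ) (max (Real.logb 2 |((r * s * t : ℤ) : ℝ)|)
      (10 + 5 * Real.logb 2 ((UniqueFactorizationMonoid.radical (r * s * t) : ℤ) : ℝ))) <
        ((min l (min m n) : ℕ) : ℝ) →
    ¬ ∃ x y z : ℤ, 2 ≤ |x * y * z| ∧ Int.gcd (Int.gcd x y) z = 1 ∧
        r * x ^ l + s * y ^ m + t * z ^ n = 0

end ExpEst

end Literature.IUT.LogVolume

end
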